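import Summits.AtomisticToContinuum.FouriersLaw.Theorems.PhononMeanFreePathCoherentDephasingResponseStatics
import Literature.MathematicalPhysics.KineticTheory.PhaseSpacePoisson

/-!
# `CoherentDephasing` / line `Sketch`, strict absorption: growth and bath-derivative bounds of `G₁`, `G₂`, `Φ`

Stub `sa_classBounds` (sub-goal K4c) of the lead's `N`-uniform strict-absorption skeleton for crux
`stmt-AtomisticToContinuum-11810` (`PhononMeanFreePath.CoherentDephasing`). For the `(N+1)`-site pinned anharmonic
chain `pinnedChain ω₂ lam β γ` (`N ≥ 2`) and the explicit kicked-site polynomials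

* `G₁ = L p₀ = -(ω₂ q₀ + lam q₀³) + ((q₁ - q₀) + β (q₁ - q₀)³) - γ p₀`,
* `G₂ = L G₁ = -p₀ Φ + p₁ (1 + 3β (q₁ - q₀)²) + γ (ω₂ q₀ + lam q₀³ - ((q₁ - q₀) + β (q₁ - q₀)³)) + γ² p₀`,
* `Φ = ω₂ + 3 lam q₀² + 1 + 3β (q₁ - q₀)²`,

we produce one constant `Cb ≥ 0` with `|G₁|, |G₂|, |∂_{p₀} G₁|, |∂_{p_N} G₁|, |∂_{p₀} G₂|, |∂_{p_N} G₂| ≤ Cb (1 + H)²`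
and `|Φ| ≤ Cb (1 + H)` pointwise (`H ≥ 0` the Hamiltonian). The partial derivatives are computed explicitly
(`∂_{p₀} G₁ = -γ`, `∂_{p₀} G₂ = -Φ + γ²`, the `∂_{p_N}` ones vanish since `N ≥ 2`), and the sizes follow from
`ω₂ q₀²/2, (q₁-q₀)²/2, p_i²/2 ≤ H`.
-/

noncomputable section

open MeasureTheory ProbabilityTheory Filter Topology Set
open scoped NNReal ENNReal

namespace Summit.AtomisticToContinuum.FouriersLaw.Theorems.CoherentDephasing.StrictAbsorption

open Literature.MathematicalPhysics.KineticTheory.HeatConduction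
open Literature.MathematicalPhysics.KineticTheory Literature.Probability.Process OscillatorChain
open Summit.AtomisticToContinuum.FouriersLaw.Theorems.CoherentDephasing.MeanFieldDuhamel

/-! ### Index bookkeeping on `Fin (N+1)`, `N ≥ 2` -/

/-- Site `1` is not site `0`. [folklore] -/
theorem classBd_one_ne_zero {N : ℕ} (hN : 2 ≤ N) : (⟨1, by omega⟩ : Fin (N + 1)) ≠ 0 := by
  intro h
  rw [Fin.ext_iff] at h
  simp at h

/-- Site `0` is not the last site `N` when `N ≥ 2`. [folklore] -/
theorem classBd_zero_ne_last {N : ℕ} (hN : 2 ≤ N) : (0 : Fin (N + 1)) ≠ Fin.last N := by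
  intro h
  rw [Fin.ext_iff] at h
  simp at h
  omega

/-- Site `1` is not the last site `N` when `N ≥ 2`. [folklore] -/
theorem classBd_one_ne_last {N : ℕ} (hN : 2 ≤ N) : (⟨1, by omega⟩ : Fin (N + 1)) ≠ Fin.last N := by
  intro h
  rw [Fin.ext_iff] at h
  simp at h
  omega

/-! ### The bath derivatives of `G₁` and `G₂` -/

/-- `∂_{p₀} G₁ = -γ`. [folklore] -/
theorem classBd_partialP_zero_G1 (ω₂ lam β γ : ℝ) {N : ℕ} (hN : 2 ≤ N) (z : PhaseSpace (N + 1)) :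
    partialP 0 (fun y : PhaseSpace (N + 1) => (-(ω₂ * y.1 0 + lam * y.1 0 ^ 3) +
      ((y.1 ⟨1, by omega⟩ - y.1 0) + β * (y.1 ⟨1, by omega⟩ - y.1 0) ^ 3) - γ * y.2 0)) z = -γ := by
  unfold partialP
  simp only [Function.update_self]
  have hd : HasDerivAt (fun t : ℝ => -(ω₂ * z.1 0 + lam * z.1 0 ^ 3) +
      ((z.1 ⟨1, by omega⟩ - z.1 0) + β * (z.1 ⟨1, by omega⟩ - z.1 0) ^ 3) - γ * t) (-(γ * 1)) (z.2 0) :=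
    ((hasDerivAt_id' (z.2 0)).const_mul γ).const_sub _
  rw [hd.deriv, mul_one]

/-- `∂_{p_N} G₁ = 0` (`N ≥ 2`: `G₁` only involves `p₀`). [folklore] -/
theorem classBd_partialP_last_G1 (ω₂ lam β γ : ℝ) {N : ℕ} (hN : 2 ≤ N) (z : PhaseSpace (N + 1)) :
    partialP (Fin.last N) (fun y : PhaseSpace (N + 1) => (-(ω₂ * y.1 0 + lam * y.1 0 ^ 3) +
      ((y.1 ⟨1, by omega⟩ - y.1 0) + β * (y.1 ⟨1, by omega⟩ - y.1 0) ^ 3) - γ * y.2 0)) z = 0 := by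
  unfold partialP
  simp only [Function.update_of_ne (classBd_zero_ne_last hN), deriv_const]

/-- `∂_{p₀} G₂ = -Φ + γ²`. [folklore] -/
theorem classBd_partialP_zero_G2 (ω₂ lam β γ : ℝ) {N : ℕ} (hN : 2 ≤ N) (z : PhaseSpace (N + 1)) :
    partialP 0 (fun y : PhaseSpace (N + 1) => (-(y.2 0 * (ω₂ + 3 * lam * y.1 0 ^ 2 + 1 +
      3 * β * (y.1 ⟨1, by omega⟩ - y.1 0) ^ 2)) + y.2 ⟨1, by omega⟩ * (1 + 3 * β * (y.1 ⟨1, by omega⟩ - y.1 0) ^ 2) +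
      γ * (ω₂ * y.1 0 + lam * y.1 0 ^ 3 - ((y.1 ⟨1, by omega⟩ - y.1 0) + β * (y.1 ⟨1, by omega⟩ - y.1 0) ^ 3)) +
      γ ^ 2 * y.2 0)) z =
      -(ω₂ + 3 * lam * z.1 0 ^ 2 + 1 + 3 * β * (z.1 ⟨1, by omega⟩ - z.1 0) ^ 2) + γ ^ 2 := by
  unfold partialP
  simp only [Function.update_self, Function.update_of_ne (classBd_one_ne_zero hN)]
  have hd : HasDerivAt (fun t : ℝ => -(t * (ω₂ + 3 * lam * z.1 0 ^ 2 + 1 +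
      3 * β * (z.1 ⟨1, by omega⟩ - z.1 0) ^ 2)) + z.2 ⟨1, by omega⟩ * (1 + 3 * β * (z.1 ⟨1, by omega⟩ - z.1 0) ^ 2) +
      γ * (ω₂ * z.1 0 + lam * z.1 0 ^ 3 - ((z.1 ⟨1, by omega⟩ - z.1 0) + β * (z.1 ⟨1, by omega⟩ - z.1 0) ^ 3)) +
      γ ^ 2 * t)
      (-(1 * (ω₂ + 3 * lam * z.1 0 ^ 2 + 1 + 3 * β * (z.1 ⟨1, by omega⟩ - z.1 0) ^ 2)) + γ ^ 2 * 1) (z.2 0) :=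
    ((((hasDerivAt_id' (z.2 0)).mul_const _).neg.add_const _).add_const _).add
      ((hasDerivAt_id' (z.2 0)).const_mul _)
  rw [hd.deriv]
  ring

/-- `∂_{p_N} G₂ = 0` (`N ≥ 2`: `G₂` only involves `p₀, p₁`). [folklore] -/
theorem classBd_partialP_last_G2 (ω₂ lam β γ : ℝ) {N : ℕ} (hN : 2 ≤ N) (z : PhaseSpace (N + 1)) :
    partialP (Fin.last N) (fun y : PhaseSpace (N + 1) => (-(y.2 0 * (ω₂ + 3 * lam * y.1 0 ^ 2 + 1 +
      3 * β * (y.1 ⟨1, by omega⟩ - y.1 0) ^ 2)) + y.2 ⟨1, by omega⟩ * (1 + 3 * β * (y.1 ⟨1, by omega⟩ - y.1 0) ^ 2) +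
      γ * (ω₂ * y.1 0 + lam * y.1 0 ^ 3 - ((y.1 ⟨1, by omega⟩ - y.1 0) + β * (y.1 ⟨1, by omega⟩ - y.1 0) ^ 3)) +
      γ ^ 2 * y.2 0)) z = 0 := by
  unfold partialP
  simp only [Function.update_of_ne (classBd_zero_ne_last hN), Function.update_of_ne (classBd_one_ne_last hN),
    deriv_const]

/-! ### Sizes -/

/-- The local curvature `Φ = ω₂ + 3 lam q₀² + 1 + 3β (q₁ - q₀)²` is nonnegative and at most
`(ω₂ + 1 + 6 lam/ω₂ + 6β)(1 + H)` (`ω₂ q₀²/2 ≤ H`, `(q₁ - q₀)²/2 ≤ H`). [folklore] -/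
theorem classBd_phi_bounds {ω₂ lam β : ℝ} (hω : 0 < ω₂) (hl : 0 ≤ lam) (hβ : 0 ≤ β) (γ : ℝ) {N : ℕ}
    (hN : 2 ≤ N) (y : PhaseSpace (N + 1)) :
    0 ≤ ω₂ + 3 * lam * y.1 0 ^ 2 + 1 + 3 * β * (y.1 ⟨1, by omega⟩ - y.1 0) ^ 2 ∧
      ω₂ + 3 * lam * y.1 0 ^ 2 + 1 + 3 * β * (y.1 ⟨1, by omega⟩ - y.1 0) ^ 2 ≤
        (ω₂ + 1 + 6 * lam / ω₂ + 6 * β) * (1 + (pinnedChain ω₂ lam β γ).hamiltonian (N + 1) y) := by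
  have hU := pinnedChain_U_le_hamiltonian hω.le hl hβ γ (N + 1) y 0
  have hb := pinnedChain_bond_le_hamiltonian hω.le hl hβ γ (N + 1) y (i := 0) (j := ⟨1, by omega⟩) (by simp)
  have hH0 := pinnedChain_hamiltonian_nonneg hω.le hl hβ γ (N + 1) y
  set H := (pinnedChain ω₂ lam β γ).hamiltonian (N + 1) y
  set q := y.1 0
  set r := y.1 ⟨1, by omega⟩ - q
  have hq4 : 0 ≤ lam * q ^ 4 / 4 := by positivity
  have hr4 : 0 ≤ β * r ^ 4 / 4 := by positivity
  have hq2 : ω₂ * q ^ 2 ≤ 2 * H := by linarith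
  have hr2 : r ^ 2 ≤ 2 * H := by linarith
  have h1 : 3 * lam * q ^ 2 ≤ 6 * lam / ω₂ * H := by
    have e : 3 * lam * q ^ 2 = 3 * lam / ω₂ * (ω₂ * q ^ 2) := by field_simp
    rw [e]
    calc 3 * lam / ω₂ * (ω₂ * q ^ 2) ≤ 3 * lam / ω₂ * (2 * H) := mul_le_mul_of_nonneg_left hq2 (by positivity)
      _ = 6 * lam / ω₂ * H := by ring
  have h2 : 3 * β * r ^ 2 ≤ 6 * β * H := by nlinarith
  have hL : 0 ≤ 6 * lam / ω₂ := by positivity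
  have hωH : 0 ≤ (ω₂ + 1) * H := by positivity
  constructor
  · positivity
  · nlinarith

/-! ### The class bounds -/

/-- SUB-GOAL K4c (growth and bath-derivative bounds): `G₁, G₂` and their `∂_{p_0}`, `∂_{p_N}` derivatives are
`O((1+H)²)`, `Φ = U''(q_0)+V''(q_1-q_0) = O(1+H)`, with one constant depending on `ω₂, lam, β, γ` only. [folklore] -/
theorem sa_classBounds :
    ∀ ω₂ lam β γ : ℝ, 0 < ω₂ → 0 < lam → 0 < β → 0 < γ → ∀ T : ℝ, 0 < T → ∀ (N : ℕ) (hN : 2 ≤ N), ∃ Cb : ℝ, 0 ≤ Cb ∧ ∀ z : PhaseSpace (N + 1), |(-(ω₂ * z.1 0 + lam * z.1 0 ^ 3) + ((z.1 ⟨1, by omega⟩ - z.1 0) + β * (z.1 ⟨1, by omega⟩ - z.1 0) ^ 3) - γ * z.2 0)| ≤ Cb * (1 + (pinnedChain ω₂ lam β γ).hamiltonian (N + 1) z) ^ 2 ∧ |(-(z.2 0 * (ω₂ + 3 * lam * z.1 0 ^ 2 + 1 + 3 * β * (z.1 ⟨1, by omega⟩ - z.1 0) ^ 2)) + z.2 ⟨1,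 by omega⟩ * (1 + 3 * β * (z.1 ⟨1, by omega⟩ - z.1 0) ^ 2) + γ * (ω₂ * z.1 0 + lam * z.1 0 ^ 3 - ((z.1 ⟨1, by omega⟩ - z.1 0) + β * (z.1 ⟨1, by omega⟩ - z.1 0) ^ 3)) + γ ^ 2 * z.2 0)| ≤ Cb * (1 + (pinnedChain ω₂ lam β γ).hamiltonian (N + 1) z) ^ 2 ∧ |partialP 0 (fun y : PhaseSpace (N + 1) => (-(ω₂ * y.1 0 + lam * y.1 0 ^ 3) + ((y.1 ⟨1, by omega⟩ - y.1 0) + β * (y.1 ⟨1, by omega⟩ - y.1 0) ^ 3) - γ * y.2 0)) z| ≤ Cb * (1 + (pinnedChain ω₂ lam β γ).hamiltonian (N + 1) z) ^ 2 ∧ |partialP (Fin.last N) (fun y : PhaseSpace (N + 1) => (-(ω₂ * y.1 0 + lam * y.1 0 ^ 3) + ((y.1 ⟨1, by omega⟩ - y.1 0) + β * (y.1 ⟨1, by omega⟩ - y.1 0) ^ 3) - γ * y.2 0)) z| ≤ Cb * (1 + (pinnedChain ω₂ lam β γ).hamiltonian (N + 1) z) ^ 2 ∧ |partialP 0 (fun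 y : PhaseSpace (N + 1) => (-(y.2 0 * (ω₂ + 3 * lam * y.1 0 ^ 2 + 1 + 3 * β * (y.1 ⟨1, by omega⟩ - y.1 0) ^ 2)) + y.2 ⟨1, by omega⟩ * (1 + 3 * β * (y.1 ⟨1, by omega⟩ - y.1 0) ^ 2) + γ * (ω₂ * y.1 0 + lam * y.1 0 ^ 3 - ((y.1 ⟨1, by omega⟩ - y.1 0) + β * (y.1 ⟨1, by omega⟩ - y.1 0) ^ 3)) + γ ^ 2 * y.2 0)) z| ≤ Cb * (1 + (pinnedChain ω₂ lam β γ).hamiltonian (N + 1) z) ^ 2 ∧ |partialP (Fin.last N) (fun y : PhaseSpace (N + 1) => (-(y.2 0 * (ω₂ + 3 * lam * y.1 0 ^ 2 + 1 + 3 * β * (y.1 ⟨1, by omega⟩ - y.1 0) ^ 2)) + y.2 ⟨1, by omega⟩ * (1 + 3 * β * (y.1 ⟨1, by omega⟩ - y.1 0) ^ 2) + γ * (ω₂ * y.1 0 + lam * y.1 0 ^ 3 - ((y.1 ⟨1, by omega⟩ - y.1 0) + β * (y.1 ⟨1, by omega⟩ - y.1 0) ^ 3)) + γ ^ 2 * y.2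 0)) z| ≤ Cb * (1 + (pinnedChain ω₂ lam β γ).hamiltonian (N + 1) z) ^ 2 ∧ |(ω₂ + 3 * lam * z.1 0 ^ 2 + 1 + 3 * β * (z.1 ⟨1, by omega⟩ - z.1 0) ^ 2)| ≤ Cb * (1 + (pinnedChain ω₂ lam β γ).hamiltonian (N + 1) z) := by
  intro ω₂ lam β γ hω hl hβ hγ T _hT N hN
  -- opaque constants for the sizes of `q₀`, `q₀³`, `Φ`
  obtain ⟨A, hA0, hA⟩ : ∃ A : ℝ, 0 ≤ A ∧ ∀ y : PhaseSpace (N + 1),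
      |y.1 0| ≤ A * (1 + (pinnedChain ω₂ lam β γ).hamiltonian (N + 1) y) :=
    ⟨1 / 2 + 1 / ω₂, by positivity, fun y => abs_fst_le hω hl.le hβ.le γ y 0⟩
  obtain ⟨B, hB0, hB⟩ : ∃ B : ℝ, 0 ≤ B ∧ ∀ y : PhaseSpace (N + 1),
      |y.1 0 ^ 3| ≤ B * (1 + (pinnedChain ω₂ lam β γ).hamiltonian (N + 1) y) ^ 2 :=
    ⟨1 / ω₂ + 2 / ω₂ ^ 2, by positivity, fun y => abs_fst_cube_le hω hl.le hβ.le γ y 0⟩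
  obtain ⟨E, hE0, hE⟩ : ∃ E : ℝ, 0 ≤ E ∧ ∀ y : PhaseSpace (N + 1),
      0 ≤ ω₂ + 3 * lam * y.1 0 ^ 2 + 1 + 3 * β * (y.1 ⟨1, by omega⟩ - y.1 0) ^ 2 ∧
        ω₂ + 3 * lam * y.1 0 ^ 2 + 1 + 3 * β * (y.1 ⟨1, by omega⟩ - y.1 0) ^ 2 ≤
          E * (1 + (pinnedChain ω₂ lam β γ).hamiltonian (N + 1) y) :=
    ⟨ω₂ + 1 + 6 * lam / ω₂ + 6 * β, by positivity, classBd_phi_bounds hω hl.le hβ.le γ hN⟩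
  have hF : ∀ y : PhaseSpace (N + 1), |(y.1 ⟨1, by omega⟩ - y.1 0) + β * (y.1 ⟨1, by omega⟩ - y.1 0) ^ 3| ≤
      (3 + β) * (1 + (pinnedChain ω₂ lam β γ).hamiltonian (N + 1) y) ^ 2 := fun y => by
    have h := abs_bondForce_le hl.le hβ.le γ hω.le y ⟨0, by omega⟩
    have e1 : (⟨0, by omega⟩ : Fin N).succ = (⟨1, by omega⟩ : Fin (N + 1)) := rfl
    have e2 : (⟨0, by omega⟩ : Fin N).castSucc = (0 : Fin (N + 1)) := rfl
    rw [e1, e2] at h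
    exact h
  have hp : ∀ (y : PhaseSpace (N + 1)) (x : Fin (N + 1)), |y.2 x| ≤ 1 + (pinnedChain ω₂ lam β γ).hamiltonian (N + 1) y :=
    fun y x => abs_snd_le hl.le hβ.le γ hω.le y x
  refine ⟨(ω₂ * A + lam * B + (3 + β) + γ) + (2 * E + γ * (ω₂ * A + lam * B + (3 + β) + γ) + γ ^ 2) + (E + γ ^ 2),
    by positivity, fun z => ?_⟩
  rw [classBd_partialP_zero_G1 ω₂ lam β γ hN z, classBd_partialP_last_G1 ω₂ lam β γ hN z,
    classBd_partialP_zero_G2 ω₂ lam β γ hN z, classBd_partialP_last_G2 ω₂ lam β γ hN z]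
  have hH0 := pinnedChain_hamiltonian_nonneg hω.le hl.le hβ.le γ (N + 1) z
  obtain ⟨hΦ0, hΦE⟩ := hE z
  have hqA := hA z
  have hqB := hB z
  have hp0 := hp z 0
  have hp1 := hp z ⟨1, by omega⟩
  have hFz := hF z
  set S := 1 + (pinnedChain ω₂ lam β γ).hamiltonian (N + 1) z with hS
  set q := z.1 0 with hq
  set q₁ := z.1 ⟨1, by omega⟩ with hq₁
  set p := z.2 0 with hp
  set p₁ := z.2 ⟨1, by omega⟩ with hp₁
  set Φ := ω₂ + 3 * lam * q ^ 2 + 1 + 3 * β * (q₁ - q) ^ 2 with hΦ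
  have hS1 : 1 ≤ S := by rw [hS]; linarith
  have hS0 : 0 ≤ S := by linarith
  have hSS : S ≤ S ^ 2 := by nlinarith
  have hS2 : 1 ≤ S ^ 2 := hS1.trans hSS
  -- term bounds
  have T1 : |ω₂ * q + lam * q ^ 3| ≤ ω₂ * (A * S) + lam * (B * S ^ 2) := by
    calc |ω₂ * q + lam * q ^ 3| ≤ |ω₂ * q| + |lam * q ^ 3| := abs_add_le _ _
      _ = ω₂ * |q| + lam * |q ^ 3| := by rw [abs_mul, abs_mul, abs_of_pos hω, abs_of_pos hl]
      _ ≤ ω₂ * (A * S) + lam * (B * S ^ 2) := by gcongr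
  have T3 : |γ * p| ≤ γ * S := by
    rw [abs_mul, abs_of_pos hγ]
    exact mul_le_mul_of_nonneg_left hp0 hγ.le
  have T4 : |p * Φ| ≤ S * (E * S) := by
    rw [abs_mul, abs_of_nonneg hΦ0]
    exact mul_le_mul hp0 hΦE hΦ0 hS0
  have h13 : 0 ≤ 1 + 3 * β * (q₁ - q) ^ 2 := by positivity
  have h13' : 1 + 3 * β * (q₁ - q) ^ 2 ≤ Φ := by
    have : 0 ≤ 3 * lam * q ^ 2 := by positivity
    rw [hΦ]
    linarith
  have T5 : |p₁ * (1 + 3 * β * (q₁ - q) ^ 2)| ≤ S * (E * S) := by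
    rw [abs_mul, abs_of_nonneg h13]
    exact mul_le_mul hp1 (h13'.trans hΦE) h13 hS0
  have T6 : |γ * (ω₂ * q + lam * q ^ 3 - ((q₁ - q) + β * (q₁ - q) ^ 3))| ≤
      γ * ((ω₂ * (A * S) + lam * (B * S ^ 2)) + (3 + β) * S ^ 2) := by
    rw [abs_mul, abs_of_pos hγ]
    exact mul_le_mul_of_nonneg_left ((abs_sub _ _).trans (add_le_add T1 hFz)) hγ.le
  have T7 : |γ ^ 2 * p| ≤ γ ^ 2 * S := by
    rw [abs_mul, abs_of_pos (by positivity)]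
    exact mul_le_mul_of_nonneg_left hp0 (by positivity)
  -- upgrading `S` to `S²`
  have hA1 : ω₂ * (A * S) ≤ ω₂ * A * S ^ 2 := by
    rw [← mul_assoc]
    exact mul_le_mul_of_nonneg_left hSS (by positivity)
  have hA1' : γ * (ω₂ * (A * S)) ≤ γ * (ω₂ * A * S ^ 2) := mul_le_mul_of_nonneg_left hA1 hγ.le
  have hγ1 : γ * S ≤ γ * S ^ 2 := mul_le_mul_of_nonneg_left hSS hγ.le
  have hγ2 : γ ^ 2 * S ≤ γ ^ 2 * S ^ 2 := mul_le_mul_of_nonneg_left hSS (by positivity)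
  have hE1 : E * S ≤ E * S ^ 2 := mul_le_mul_of_nonneg_left hSS hE0
  have hγS : γ ≤ γ * S ^ 2 := le_mul_of_one_le_right hγ.le hS2
  have hγγS : γ ^ 2 ≤ γ ^ 2 * S ^ 2 := le_mul_of_one_le_right (by positivity) hS2
  -- nonnegative slack terms
  have n1 : 0 ≤ ω₂ * A * S ^ 2 := by positivity
  have n2 : 0 ≤ lam * B * S ^ 2 := by positivity
  have n3 : 0 ≤ (3 + β) * S ^ 2 := by positivity
  have n4 : 0 ≤ γ * S ^ 2 := by positivity
  have n5 : 0 ≤ E * S ^ 2 := by positivity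
  have n6 : 0 ≤ γ ^ 2 * S ^ 2 := by positivity
  have n7 : 0 ≤ γ * (ω₂ * A + lam * B + (3 + β) + γ) * S ^ 2 := by positivity
  have n8 : 0 ≤ (ω₂ * A + lam * B + (3 + β) + γ) * S := by positivity
  have n9 : 0 ≤ (2 * E + γ * (ω₂ * A + lam * B + (3 + β) + γ) + γ ^ 2) * S := by positivity
  have n10 : 0 ≤ γ ^ 2 * S := by positivity
  refine ⟨?_, ?_, ?_, ?_, ?_, ?_, ?_⟩
  · -- `|G₁|`
    have e1 : |-(ω₂ * q + lam * q ^ 3) + ((q₁ - q) + β * (q₁ - q) ^ 3) - γ * p| ≤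
        |ω₂ * q + lam * q ^ 3| + |(q₁ - q) + β * (q₁ - q) ^ 3| + |γ * p| :=
      (abs_sub _ _).trans (add_le_add ((abs_add_le _ _).trans (add_le_add (abs_neg _).le le_rfl)) le_rfl)
    linarith
  · -- `|G₂|`
    have e2 : |-(p * Φ) + p₁ * (1 + 3 * β * (q₁ - q) ^ 2) +
        γ * (ω₂ * q + lam * q ^ 3 - ((q₁ - q) + β * (q₁ - q) ^ 3)) + γ ^ 2 * p| ≤
        |p * Φ| + |p₁ * (1 + 3 * β * (q₁ - q) ^ 2)| +
          |γ * (ω₂ * q + lam * q ^ 3 - ((q₁ - q) + β * (q₁ - q) ^ 3))| + |γ ^ 2 * p| :=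
      (abs_add_le _ _).trans (add_le_add ((abs_add_le _ _).trans (add_le_add ((abs_add_le _ _).trans
        (add_le_add (abs_neg _).le le_rfl)) le_rfl)) le_rfl)
    linarith
  · -- `|∂_{p₀} G₁| = γ`
    rw [abs_neg, abs_of_pos hγ]
    linarith
  · -- `|∂_{p_N} G₁| = 0`
    rw [abs_zero]
    positivity
  · -- `|∂_{p₀} G₂| = |-Φ + γ²|`
    have e5 : |-Φ + γ ^ 2| ≤ Φ + γ ^ 2 := by
      calc |-Φ + γ ^ 2| ≤ |-Φ| + |γ ^ 2| := abs_add_le _ _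
        _ = Φ + γ ^ 2 := by rw [abs_neg, abs_of_nonneg hΦ0, abs_of_nonneg (by positivity)]
    linarith
  · -- `|∂_{p_N} G₂| = 0`
    rw [abs_zero]
    positivity
  · -- `|Φ|`
    rw [abs_of_nonneg hΦ0]
    linarith

end Summit.AtomisticToContinuum.FouriersLaw.Theorems.CoherentDephasing.StrictAbsorption

end
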